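import Summits.ResolutionOfSingularities.ResolutionOfSingularities.Theorems.MarkedTransferCampaignW22CharTwoTaylor
import Summits.ResolutionOfSingularities.ResolutionOfSingularities.Theorems.MarkedTransferCampaignW22CharTwoNormalise
import Summits.ResolutionOfSingularities.ResolutionOfSingularities.Theorems.MarkedTransferCampaignW22GraphPairSymbolicOrderEasy
import HarnessLib

/-!
# [OURS · L1 W2.2 (γ)] A(2) IN CHARACTERISTIC 2, IN THE KERNEL: the `e = 1` slice of `GraphPairSymbolicOrderOn 2 K`
# (p529003) for EVERY perfect field `K` of characteristic 2 — `(X 0,X 1,X 2)² ∩ (X i − f i)² ⊆ 𝔪³` for every graph pair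
# of `K⟦X_{Fin 5}⟧` with `(X 0,X 1,X 2) ∩ (X i − f i) ⊆ 𝔪²` (RESCUE-SEED slot W2.2, group L-G2; cell `res-hironaka`, rung L)

Cell `res-hironaka` (run/shared/lean/pub/res-hironaka/), rung L, plan/RESCUE-SEED.md §1 row L-G2 slot W2.2; seat
res-L1-s22-pv-1 (prover pv-1, gen 6); `--supports` helper of `MarkedTransfer.MarkedOrderReductionP`
(stmt-ResolutionOfSingularities-15520). Everything PROVED; no definitions; no Literature fact (the tree's discharged F-37 enters
through p548432).
HONEST FRAMING. Everything here is OURS; NOTHING here is a statement of H. Hironaka's manuscript *Resolution of singularities in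
positive characteristics* (2017-03-23, [Hironaka2017], lit key `paper:url-3343fd9e678b`) or of any cited paper, and nothing
asserts that any statement of that text holds. This file PROVES one slice (`q = p = 2`) of an OURS candidate row; it does not
decide the row (`e ≥ 2` open) and says nothing about the manuscript. AI mathematics, kernel-checked; weaker than expert review.

THE THEOREM (`graphPair_sq_inf_sq_le_pow_three`, and in the literal shape of p529003's schema at `e = 1`,
`graphPairSymbolicOrderOn_two_level_one`). `K` perfect of characteristic 2, `f : Fin 3 → K⟦X_{Fin 5}⟧` supported on the
monomials in `X 3, X 4` and without constant term, `P₁ = (X 0, X 1, X 2)`, `P₂ = (X 0 − f 0, X 1 − f 1, X 2 − f 2)`: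
`P₁ ⊓ P₂ ≤ 𝔪² ⟹ P₁² ⊓ P₂² ≤ 𝔪³`. This is the kernel form of this seat's hand proof THEOREM-A2-CHAR2.md (2026-08-27T14:28Z,
second-read by res-L1-type-o3 and res-type-014), assembled from p549704 (`CharTwoTaylor.exists_data`: first-order Taylor
extraction), p548432 (`CharTwoNormalise.false_of_data`: normalisation + regular complement by unique factorisation), p547555
(`CharTwoCore.head_mem_span_pair`: E-equation) and p546026 (`TransitionDeterminant`: socle of the complete intersection, LEMMA Z′);
the hand proof's infinite-field device is not needed (finite `K` covered).

ASSEMBLY STEPS proved here (namespace `…Theorems.CampaignW22.GraphPairCharTwo`): `exists_mem_of_mem_mul_span_triple` (elements of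
`𝔪·(f₁,f₂,f₃)`), `coeff_single_mul_X` (plumbing), **`minimal_of_inf_le_sq`** (`P₁ ⊓ P₂ ≤ 𝔪² ⟹ (f₁,f₂,f₃)` is minimally 3-generated:
a relation with a unit coefficient gives an order-1 element of `P₁ ∩ P₂`), `constantCoeff_eq_zero_of_minimal`, `mem_sq_of_mul_mem_sq`
/ `mul_mem_mul_span_of_mem` / `minimal_descend` (passage to `f = h·g`), **`exists_coprime_factorisation`** (`f = h·g` with `g` coprime,
by `UniqueFactorizationMonoid.exists_reduced_factors` twice), `sq_inf_sq_le_pow_three` (base series given in `K⟦X_{Fin 2}⟧`),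
`eq_rename_killCompl` (a series supported in `X 3, X 4` comes from `K⟦X_{Fin 2}⟧`, by `Jets.algHom_ext_X`), and the two final forms.

## References
* Cell files: L/res-L1-s22-pv-1/THEOREM-A2-CHAR2.md, AQ2-EXACT.md; tree p549704, p548432, p547555, p546026 (this seat),
  p529003 (`GraphPairSymbolicOrderOn`, res-L1-type-o3), p539538 (res-type-014), `…W22GraphPairFaces.lean` (p509693),
  `…W22GraphPairSymbolicOrderEasy.lean`; STATUS res-L1-s22-pv-1 2026-08-27T14:28:00Z / 15:52:10Z.
* H. Hironaka, ms. 2017-03-23, p.85 l.3 — ROLE only (the cell this serves); not cited as fact. [Hironaka2017]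
  [claim: Hironaka2017, status: under-review]
-/

set_option linter.dupNamespace false -- mandated namespace of this single-conjunct summit

noncomputable section
namespace Summit.ResolutionOfSingularities.ResolutionOfSingularities.Theorems
namespace CampaignW22
namespace GraphPairCharTwo

open IsLocalRing MvPowerSeries Literature.AlgebraicGeometry.Resolution
open Literature.RingTheory.TwoVariableSeries (isDomain_mvPowerSeries)
open Literature.RingTheory.MvPowerSeries.monoidPowerSeries (faceRestrictFun)
open Literature.RingTheory.MvPowerSeries.Jets (mem_maximalIdeal_iff_constantCoeff_eq_zero
  coeff_eq_zero_of_mem_maximalIdeal_pow)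

/-! ## Minimal 3-generation from `P₁ ⊓ P₂ ≤ 𝔪²` -/

section AnyField

variable (K : Type) [Field K]

/-- [OURS · L1 W2.2] Elements of `𝔪 · (f₁, f₂, f₃)` are `m₁f₁ + m₂f₂ + m₃f₃` with `mᵢ ∈ 𝔪`. [folklore] -/
theorem exists_mem_of_mem_mul_span_triple {R : Type*} [CommRing R] (M : Ideal R) {f₁ f₂ f₃ x : R}
    (hx : x ∈ M * Ideal.span {f₁, f₂, f₃}) :
    ∃ m₁ m₂ m₃ : R, m₁ ∈ M ∧ m₂ ∈ M ∧ m₃ ∈ M ∧ x = m₁ * f₁ + m₂ * f₂ + m₃ * f₃ := by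
  refine Submodule.mul_induction_on hx (fun y hy z hz => ?_) ?_
  · obtain ⟨z₁, z', hz', rfl⟩ := Ideal.mem_span_insert.mp hz
    obtain ⟨z₂, z₃, rfl⟩ := Ideal.mem_span_pair.mp hz'
    exact ⟨y * z₁, y * z₂, y * z₃, Ideal.mul_mem_right _ _ hy, Ideal.mul_mem_right _ _ hy,
      Ideal.mul_mem_right _ _ hy, by ring⟩
  · rintro y z ⟨m₁, m₂, m₃, h₁, h₂, h₃, rfl⟩ ⟨n₁, n₂, n₃, k₁, k₂, k₃, rfl⟩
    exact ⟨m₁ + n₁, m₂ + n₂, m₃ + n₃, add_mem h₁ k₁, add_mem h₂ k₂, add_mem h₃ k₃, by ring⟩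

/-- [OURS · L1 W2.2] plumbing: the coefficient of `X i` in `φ · X j` is `δ_ij · φ(0)`. [folklore] -/
theorem coeff_single_mul_X {σ : Type*} [DecidableEq σ] (φ : MvPowerSeries σ K) (i j : σ) :
    coeff (Finsupp.single i 1) (φ * X j) = if i = j then constantCoeff φ else 0 := by
  rw [X_def, coeff_mul_monomial, mul_one]
  by_cases hij : i = j
  · subst hij
    rw [if_pos le_rfl, if_pos rfl, tsub_self, coeff_zero_eq_constantCoeff_apply]
  · rw [if_neg, if_neg hij]
    intro h
    have := h j
    simp [Ne.symm hij] at this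

/-- [OURS · L1 W2.2] **`P₁ ⊓ P₂ ≤ 𝔪²` forces minimal 3-generation of `(f₁, f₂, f₃)`**: `O = K⟦X_{Fin 5}⟧`, `ι = rename e`
(`e 0 = 3`, `e 1 = 4`), `P₁ = (X 0, X 1, X 2)`, `P₂ = (X i − ι fᵢ)`; if `P₁ ⊓ P₂ ≤ 𝔪²` then every relation
`c₁f₁ + c₂f₂ + c₃f₃ ∈ 𝔪_A (f₁,f₂,f₃)` has `cᵢ ∈ 𝔪_A` — else `Σ ι(cᵢ − mᵢ) X_i` is an order-1 element of `P₁ ∩ P₂`. NOT a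
statement of the manuscript. [folklore] -/
theorem minimal_of_inf_le_sq (e : Fin 2 ↪ Fin 5) (f₁ f₂ f₃ : MvPowerSeries (Fin 2) K)
    (hle : Ideal.span {(X 0 : MvPowerSeries (Fin 5) K), X 1, X 2} ⊓
      Ideal.span {X 0 - rename e f₁, X 1 - rename e f₂, X 2 - rename e f₃} ≤
        maximalIdeal (MvPowerSeries (Fin 5) K) ^ 2)
    (c₁ c₂ c₃ : MvPowerSeries (Fin 2) K)
    (hc : c₁ * f₁ + c₂ * f₂ + c₃ * f₃ ∈ maximalIdeal (MvPowerSeries (Fin 2) K) * Ideal.span {f₁, f₂, f₃}) :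
    constantCoeff c₁ = 0 ∧ constantCoeff c₂ = 0 ∧ constantCoeff c₃ = 0 := by
  classical
  obtain ⟨m₁, m₂, m₃, hm₁, hm₂, hm₃, hrel⟩ := exists_mem_of_mem_mul_span_triple _ hc
  set ι := rename (R := K) e with hι
  set G : MvPowerSeries (Fin 5) K := ι (c₁ - m₁) * X 0 + ι (c₂ - m₂) * X 1 + ι (c₃ - m₃) * X 2 with hG
  have hG₁ : G ∈ Ideal.span {(X 0 : MvPowerSeries (Fin 5) K), X 1, X 2} :=
    add_mem (add_mem (Ideal.mul_mem_left _ _ (Ideal.subset_span (by simp)))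
      (Ideal.mul_mem_left _ _ (Ideal.subset_span (by simp)))) (Ideal.mul_mem_left _ _ (Ideal.subset_span (by simp)))
  have hG₂ : G ∈ Ideal.span {X 0 - rename e f₁, X 1 - rename e f₂, X 2 - rename e f₃} := by
    have hzero : (c₁ - m₁) * f₁ + (c₂ - m₂) * f₂ + (c₃ - m₃) * f₃ = 0 := by linear_combination hrel
    have eG : G = ι (c₁ - m₁) * (X 0 - rename e f₁) + ι (c₂ - m₂) * (X 1 - rename e f₂) +
        ι (c₃ - m₃) * (X 2 - rename e f₃) + ι ((c₁ - m₁) * f₁ + (c₂ - m₂) * f₂ + (c₃ - m₃) * f₃) := by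
      rw [hG, hι]; simp only [map_add, map_mul, map_sub]; ring
    rw [eG, hzero, map_zero, add_zero]
    exact add_mem (add_mem (Ideal.mul_mem_left _ _ (Ideal.subset_span (by simp)))
      (Ideal.mul_mem_left _ _ (Ideal.subset_span (by simp)))) (Ideal.mul_mem_left _ _ (Ideal.subset_span (by simp)))
  have hG𝔪 : G ∈ maximalIdeal (MvPowerSeries (Fin 5) K) ^ 2 := hle ⟨hG₁, hG₂⟩
  have hdeg : ∀ i : Fin 5, (Finsupp.single i 1).degree < 2 := fun i => by
    rw [Finsupp.degree_single]; omega
  have hcoef : ∀ i : Fin 5, coeff (Finsupp.single i 1) G = 0 := fun i =>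
    coeff_eq_zero_of_mem_maximalIdeal_pow hG𝔪 (hdeg i)
  have h0 := hcoef 0
  have h1 := hcoef 1
  have h2 := hcoef 2
  simp only [hG, map_add, coeff_single_mul_X, hι, constantCoeff_rename, map_sub] at h0 h1 h2
  simp only [Fin.isValue, Fin.reduceEq, ↓reduceIte, add_zero, zero_add] at h0 h1 h2
  have e₁ := mem_maximalIdeal_iff_constantCoeff_eq_zero.mp hm₁
  have e₂ := mem_maximalIdeal_iff_constantCoeff_eq_zero.mp hm₂
  have e₃ := mem_maximalIdeal_iff_constantCoeff_eq_zero.mp hm₃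
  refine ⟨?_, ?_, ?_⟩
  · rw [e₁, sub_zero] at h0; exact h0
  · rw [e₂, sub_zero] at h1; exact h1
  · rw [e₃, sub_zero] at h2; exact h2

/-- [OURS · L1 W2.2] A minimally 3-generating triple consists of non-units. [folklore] -/
theorem constantCoeff_eq_zero_of_minimal {f₁ f₂ f₃ : MvPowerSeries (Fin 2) K}
    (hM : ∀ c₁ c₂ c₃ : MvPowerSeries (Fin 2) K,
      c₁ * f₁ + c₂ * f₂ + c₃ * f₃ ∈ maximalIdeal (MvPowerSeries (Fin 2) K) * Ideal.span {f₁, f₂, f₃} →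
        constantCoeff c₁ = 0 ∧ constantCoeff c₂ = 0 ∧ constantCoeff c₃ = 0) :
    constantCoeff f₁ = 0 ∧ constantCoeff f₂ = 0 ∧ constantCoeff f₃ = 0 := by
  have z₁ : f₂ * f₁ + -f₁ * f₂ + 0 * f₃ = 0 := by ring
  have z₂ : -f₂ * f₁ + f₁ * f₂ + 0 * f₃ = 0 := by ring
  have z₃ : -f₃ * f₁ + 0 * f₂ + f₁ * f₃ = 0 := by ring
  refine ⟨?_, ?_, ?_⟩
  · have h := (hM f₂ (-f₁) 0 (by rw [z₁]; exact Submodule.zero_mem _)).2.1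
    rwa [map_neg, neg_eq_zero] at h
  · have h := (hM (-f₂) f₁ 0 (by rw [z₂]; exact Submodule.zero_mem _)).1
    rwa [map_neg, neg_eq_zero] at h
  · have h := (hM (-f₃) 0 f₁ (by rw [z₃]; exact Submodule.zero_mem _)).1
    rwa [map_neg, neg_eq_zero] at h

/-! ## Passage to a coprime triple `f = h · g` -/

/-- [OURS · L1 W2.2] In a domain: `x h ∈ (h g₁, h g₂, h g₃)² ⟹ x ∈ (g₁, g₂, g₃)²` (`h ≠ 0`). [folklore] -/
theorem mem_sq_of_mul_mem_sq {R : Type*} [CommRing R] [IsDomain R] {h x g₁ g₂ g₃ : R} (hh : h ≠ 0)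
    (hx : x * h ∈ Ideal.span {h * g₁, h * g₂, h * g₃} ^ 2) : x ∈ Ideal.span {g₁, g₂, g₃} ^ 2 := by
  have hle : Ideal.span {h * g₁, h * g₂, h * g₃} ≤ Ideal.span {h} * Ideal.span {g₁, g₂, g₃} := by
    refine Ideal.span_le.mpr ?_
    rintro y (rfl | rfl | rfl) <;>
      exact Ideal.mul_mem_mul (Ideal.mem_span_singleton_self h) (Ideal.subset_span (by simp))
  have hx' : x * h ∈ Ideal.span {h ^ 2} * Ideal.span {g₁, g₂, g₃} ^ 2 := by
    have := Ideal.pow_right_mono hle 2 hx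
    rwa [mul_pow, Ideal.span_singleton_pow] at this
  obtain ⟨j, hj, hxj⟩ := Ideal.mem_span_singleton_mul.mp hx'
  have : h * (x - h * j) = 0 := by linear_combination (-1 : R) * hxj
  have hx2 : x = h * j := by
    have := (mul_eq_zero.mp this).resolve_left hh
    linear_combination this
  rw [hx2]
  exact Ideal.mul_mem_left _ _ hj

/-- [OURS · L1 W2.2] `x ∈ 𝔪·(g₁,g₂,g₃) ⟹ h x ∈ 𝔪·(h g₁, h g₂, h g₃)`. [folklore] -/
theorem mul_mem_mul_span_of_mem {R : Type*} [CommRing R] (M : Ideal R) {h x g₁ g₂ g₃ : R}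
    (hx : x ∈ M * Ideal.span {g₁, g₂, g₃}) : h * x ∈ M * Ideal.span {h * g₁, h * g₂, h * g₃} := by
  obtain ⟨m₁, m₂, m₃, h₁, h₂, h₃, rfl⟩ := exists_mem_of_mem_mul_span_triple M hx
  have e : h * (m₁ * g₁ + m₂ * g₂ + m₃ * g₃) = m₁ * (h * g₁) + m₂ * (h * g₂) + m₃ * (h * g₃) := by ring
  rw [e]
  exact add_mem (add_mem (Ideal.mul_mem_mul h₁ (Ideal.subset_span (by simp)))
    (Ideal.mul_mem_mul h₂ (Ideal.subset_span (by simp)))) (Ideal.mul_mem_mul h₃ (Ideal.subset_span (by simp)))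

/-- [OURS · L1 W2.2] Minimal 3-generation descends from `(h g₁, h g₂, h g₃)` to `(g₁, g₂, g₃)`. [folklore] -/
theorem minimal_descend {h g₁ g₂ g₃ : MvPowerSeries (Fin 2) K}
    (hM : ∀ c₁ c₂ c₃ : MvPowerSeries (Fin 2) K,
      c₁ * (h * g₁) + c₂ * (h * g₂) + c₃ * (h * g₃) ∈
          maximalIdeal (MvPowerSeries (Fin 2) K) * Ideal.span {h * g₁, h * g₂, h * g₃} →
        constantCoeff c₁ = 0 ∧ constantCoeff c₂ = 0 ∧ constantCoeff c₃ = 0)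
    (c₁ c₂ c₃ : MvPowerSeries (Fin 2) K)
    (hc : c₁ * g₁ + c₂ * g₂ + c₃ * g₃ ∈ maximalIdeal (MvPowerSeries (Fin 2) K) * Ideal.span {g₁, g₂, g₃}) :
    constantCoeff c₁ = 0 ∧ constantCoeff c₂ = 0 ∧ constantCoeff c₃ = 0 := by
  refine hM c₁ c₂ c₃ ?_
  have e : c₁ * (h * g₁) + c₂ * (h * g₂) + c₃ * (h * g₃) = h * (c₁ * g₁ + c₂ * g₂ + c₃ * g₃) := by ring
  rw [e]
  exact mul_mem_mul_span_of_mem _ hc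

/-- [OURS · L1 W2.2] **gcd extraction** in the factorial domain `K⟦X 0, X 1⟧` (tree F-37): every triple with `f₁ ≠ 0` is
`h · (g₁, g₂, g₃)` with no prime element dividing all of `g₁, g₂, g₃` (`exists_reduced_factors` twice). [folklore] -/
theorem exists_coprime_factorisation (f₁ f₂ f₃ : MvPowerSeries (Fin 2) K) (hf₁ : f₁ ≠ 0) :
    ∃ h g₁ g₂ g₃ : MvPowerSeries (Fin 2) K, f₁ = h * g₁ ∧ f₂ = h * g₂ ∧ f₃ = h * g₃ ∧
      ∀ π : MvPowerSeries (Fin 2) K, Prime π → π ∣ g₁ → π ∣ g₂ → π ∣ g₃ → False := by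
  haveI := isDomain_mvPowerSeries (F := K) (Fin 2)
  haveI := CharTwoNormalise.uniqueFactorizationMonoid K
  obtain ⟨f₁', f₂', c, hcop, hc₁, hc₂⟩ := UniqueFactorizationMonoid.exists_reduced_factors f₁ hf₁ f₂
  have hc0 : c ≠ 0 := by rintro rfl; exact hf₁ (by rw [← hc₁, zero_mul])
  obtain ⟨c', f₃', d, hcop', hd₁, hd₂⟩ := UniqueFactorizationMonoid.exists_reduced_factors c hc0 f₃
  refine ⟨d, c' * f₁', c' * f₂', f₃', ?_, ?_, ?_, fun π hπ hπ₁ hπ₂ hπ₃ => ?_⟩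
  · rw [← hc₁, ← hd₁]; ring
  · rw [← hc₂, ← hd₁]; ring
  · rw [hd₂]
  · by_cases hπc : π ∣ c'
    · exact hπ.not_unit (hcop' hπc hπ₃)
    · exact hπ.not_unit (hcop ((hπ.dvd_or_dvd hπ₁).resolve_left hπc) ((hπ.dvd_or_dvd hπ₂).resolve_left hπc))

/-- [OURS · L1 W2.2] plumbing: a series of `K⟦X_{Fin 5}⟧` fixed by the face projection onto the monomials in `X 3, X 4` is the
image under `rename e` (`e = (3, 4)`) of its restriction `killCompl e` (two `K`-algebra endomorphisms agreeing on the variables,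
`Jets.algHom_ext_X`). [folklore] -/
theorem eq_rename_killCompl (e : Fin 2 ↪ Fin 5) (he₀ : e 0 = 3) (he₁ : e 1 = 4) {f : MvPowerSeries (Fin 5) K}
    (hf : faceRestrictFun (R := K) (Finsupp.supported ℕ ℕ (({0, 1, 2} : Set (Fin 5))ᶜ)).toAddSubmonoid f = f) :
    f = rename e (killCompl e f) := by
  classical
  have hF := mem_supported_compl_iff ({0, 1, 2} : Set (Fin 5))
  obtain ⟨π, hπ⟩ := exists_algHom_eq_faceRestrictFun (K := K) hF
  have hrange : ∀ i : Fin 5, i ∈ Set.range e ↔ i ∉ ({0, 1, 2} : Set (Fin 5)) := by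
    intro i
    constructor
    · rintro ⟨j, rfl⟩
      fin_cases j
      · simp [he₀]
      · simp [he₁]
    · intro hi
      have hi' : i = 3 ∨ i = 4 := by fin_cases i <;> simp_all
      rcases hi' with rfl | rfl
      · exact ⟨0, he₀⟩
      · exact ⟨1, he₁⟩
  have hπψ : π = (rename e).comp (killCompl e) := by
    refine Literature.RingTheory.MvPowerSeries.Jets.algHom_ext_X fun i => ?_
    rw [hπ, AlgHom.comp_apply]
    by_cases hi : i ∈ ({0, 1, 2} : Set (Fin 5))
    · rw [faceRestrictFun_X_of_mem hF hi, killCompl_X_eq_zero (fun h => ((hrange i).mp h) hi), map_zero]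
    · obtain ⟨j, rfl⟩ := (hrange i).mpr hi
      rw [faceRestrictFun_X_of_not_mem hF hi, killCompl_X, rename_X]
  have := congrArg (fun φ => φ f) hπψ
  simp only [AlgHom.comp_apply, hπ, hf] at this
  exact this

end AnyField

/-! ## A(2) in characteristic 2 -/

section CharTwo

variable (K : Type) [Field K] [CharP K 2] [PerfectField K]

/-- [OURS · L1 W2.2 (γ)] **A(2) IN CHARACTERISTIC 2** with the base series given in `K⟦X_{Fin 2}⟧`: for `K` perfect of
characteristic 2, `ι = rename e` (`e 0 = 3`, `e 1 = 4`), `f₁ f₂ f₃ ∈ 𝔪`, `P₁ = (X 0, X 1, X 2)`, `P₂ = (X i − ι fᵢ)`: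
`P₁ ⊓ P₂ ≤ 𝔪² ⟹ P₁² ⊓ P₂² ≤ 𝔪³`. Proof: an `F ∈ P₁² ∩ P₂² ∖ 𝔪³` gives data (p549704); `P₁ ⊓ P₂ ≤ 𝔪²` gives minimal
3-generation; write `f = h·g` with `g` coprime (gcd extraction), the data and minimality descend to `g`; then
`CharTwoNormalise.false_of_data` (p548432). NOT a statement of the manuscript or of any cited paper. [folklore] -/
theorem sq_inf_sq_le_pow_three (e : Fin 2 ↪ Fin 5) (he₀ : e 0 = 3) (he₁ : e 1 = 4)
    (f₁ f₂ f₃ : MvPowerSeries (Fin 2) K) (h₁ : constantCoeff f₁ = 0) (h₂ : constantCoeff f₂ = 0)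
    (h₃ : constantCoeff f₃ = 0)
    (hle : Ideal.span {(X 0 : MvPowerSeries (Fin 5) K), X 1, X 2} ⊓
      Ideal.span {X 0 - rename e f₁, X 1 - rename e f₂, X 2 - rename e f₃} ≤
        maximalIdeal (MvPowerSeries (Fin 5) K) ^ 2) :
    Ideal.span {(X 0 : MvPowerSeries (Fin 5) K), X 1, X 2} ^ 2 ⊓
      Ideal.span {X 0 - rename e f₁, X 1 - rename e f₂, X 2 - rename e f₃} ^ 2 ≤
        maximalIdeal (MvPowerSeries (Fin 5) K) ^ 3 := by
  haveI := isDomain_mvPowerSeries (F := K) (Fin 2)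
  rintro F ⟨hF₁, hF₂⟩
  by_contra hF₃
  obtain ⟨a₁, a₂, a₃, b₁₂, b₁₃, b₂₃, hE0, hR1, hR2, hR3, hU⟩ :=
    CharTwoTaylor.exists_data K e he₀ he₁ f₁ f₂ f₃ h₁ h₂ h₃ hF₁ hF₂ hF₃
  have hM := minimal_of_inf_le_sq K e f₁ f₂ f₃ hle
  have hf₁0 : f₁ ≠ 0 := by
    intro h
    have := (hM 1 0 0 (by rw [h]; simp)).1
    simp at this
  obtain ⟨h, g₁, g₂, g₃, rfl, rfl, rfl, hP⟩ := exists_coprime_factorisation K f₁ f₂ f₃ hf₁0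
  have hh : h ≠ 0 := by rintro rfl; exact hf₁0 (zero_mul _)
  have hMg := minimal_descend K hM
  obtain ⟨hg₁, hg₂, hg₃⟩ := constantCoeff_eq_zero_of_minimal K hMg
  refine CharTwoNormalise.false_of_data K g₁ g₂ g₃ a₁ a₂ a₃ b₁₂ b₁₃ b₂₃ hg₁ hg₂ hg₃ hMg hP ?_ ?_ ?_ ?_ hU
  · have e0 : h ^ 2 * (a₁ * g₁ ^ 2 + a₂ * g₂ ^ 2 + a₃ * g₃ ^ 2 + b₁₂ * g₁ * g₂ + b₁₃ * g₁ * g₃ + b₂₃ * g₂ * g₃)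
        = 0 := by linear_combination hE0
    exact (mul_eq_zero.mp e0).resolve_left (pow_ne_zero 2 hh)
  · exact mem_sq_of_mul_mem_sq hh (by convert hR1 using 1; ring)
  · exact mem_sq_of_mul_mem_sq hh (by convert hR2 using 1; ring)
  · exact mem_sq_of_mul_mem_sq hh (by convert hR3 using 1; ring)

/-- [OURS · L1 W2.2 (γ)] **A(2) IN CHARACTERISTIC 2 — the `e = 1` slice of `GraphPairSymbolicOrderOn 2 K` (p529003) for every
perfect field `K` of characteristic 2.** For `f : Fin 3 → K⟦X_{Fin 5}⟧` supported on the monomials in `X 3, X 4` and without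
constant term, with `P₁ = (X 0, X 1, X 2)`, `P₂ = (X 0 − f 0, X 1 − f 1, X 2 − f 2)`: `P₁ ⊓ P₂ ≤ 𝔪² ⟹ P₁² ⊓ P₂² ≤ 𝔪³`.
Kernel form of this seat's hand proof THEOREM-A2-CHAR2.md; the cases `e ≥ 2` (`q = 4, 8, …`) of the row remain OPEN. NOT a
statement of the manuscript or of any cited paper. [folklore] -/
theorem graphPair_sq_inf_sq_le_pow_three (f : Fin 3 → MvPowerSeries (Fin 5) K)
    (hf : ∀ i, faceRestrictFun (R := K) (Finsupp.supported ℕ ℕ (({0, 1, 2} : Set (Fin 5))ᶜ)).toAddSubmonoid (f i) = f i)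
    (hf0 : ∀ i, constantCoeff (f i) = 0)
    (hle : Ideal.span {(X 0 : MvPowerSeries (Fin 5) K), X 1, X 2} ⊓
      Ideal.span {X 0 - f 0, X 1 - f 1, X 2 - f 2} ≤ maximalIdeal (MvPowerSeries (Fin 5) K) ^ 2) :
    Ideal.span {(X 0 : MvPowerSeries (Fin 5) K), X 1, X 2} ^ 2 ⊓ Ideal.span {X 0 - f 0, X 1 - f 1, X 2 - f 2} ^ 2 ≤
      maximalIdeal (MvPowerSeries (Fin 5) K) ^ 3 := by
  classical
  let e : Fin 2 ↪ Fin 5 := ⟨![3, 4], fun a b h => by fin_cases a <;> fin_cases b <;> simp_all⟩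
  have he₀ : e 0 = 3 := rfl
  have he₁ : e 1 = 4 := rfl
  have hk : ∀ i, f i = rename e (killCompl e (f i)) := fun i => eq_rename_killCompl K e he₀ he₁ (hf i)
  have hk0 : ∀ i, constantCoeff (killCompl e (f i)) = 0 := fun i => by
    rw [← coeff_zero_eq_constantCoeff_apply, coeff_killCompl, Finsupp.embDomain_zero,
      coeff_zero_eq_constantCoeff_apply, hf0]
  have h := sq_inf_sq_le_pow_three K e he₀ he₁ (killCompl e (f 0)) (killCompl e (f 1)) (killCompl e (f 2))
    (hk0 0) (hk0 1) (hk0 2)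
  rw [← hk 0, ← hk 1, ← hk 2] at h
  exact h hle

/-- [OURS · L1 W2.2 (γ)] The same, in the literal shape of the body of `GraphPairSymbolicOrderOn 2 K` (p529003) at `e = 1`
(`P₁ ^ 2 ^ 1 ⊓ P₂ ^ 2 ^ 1 ≤ 𝔪 ^ (2 ^ 1 + 1)`), for every perfect field `K` of characteristic 2. NOT a statement of the manuscript
or of any cited paper. [folklore] -/
theorem graphPairSymbolicOrderOn_two_level_one (f : Fin 3 → MvPowerSeries (Fin 5) K)
    (hf : ∀ i, faceRestrictFun (R := K) (Finsupp.supported ℕ ℕ (({0, 1, 2} : Set (Fin 5))ᶜ)).toAddSubmonoid (f i) = f i)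
    (hf0 : ∀ i, constantCoeff (f i) = 0) :
    let P₁ : Ideal (MvPowerSeries (Fin 5) K) := Ideal.span {X 0, X 1, X 2}
    let P₂ : Ideal (MvPowerSeries (Fin 5) K) := Ideal.span {X 0 - f 0, X 1 - f 1, X 2 - f 2}
    P₁ ⊓ P₂ ≤ maximalIdeal (MvPowerSeries (Fin 5) K) ^ 2 →
      P₁ ^ 2 ^ 1 ⊓ P₂ ^ 2 ^ 1 ≤ maximalIdeal (MvPowerSeries (Fin 5) K) ^ (2 ^ 1 + 1) := by
  intro P₁ P₂ hle
  have h := graphPair_sq_inf_sq_le_pow_three K f hf hf0 hle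
  simpa [P₁, P₂] using h

end CharTwo

end GraphPairCharTwo
end CampaignW22
end Summit.ResolutionOfSingularities.ResolutionOfSingularities.Theorems

end
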